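import Summits.NavierStokesRegularity.NavierStokesRegularity.Theorems.PalasekTowerBreakdownEpisodeBaseShadowedRun

/-! # Skeleton line `straindoor` for the crux `EpisodeBase` (= `EpisodeBaseG`, register `TowerRates.wide`) —
THE CERTIFICATE ROAD IN STRAIN CURRENCY

Strategist seat `cstrat-19179` (planner-cstrat-stmt-NavierStokesRegularity-19179-g0-0), 2026-08-27, cell `ns-blowup`.
A line PARALLEL to the lead's `Lines/slot.lean` (v5, stub `stub_explicit_slice_run`: an EXACT explicit free window run),
sharing nothing with it but the crux and the landed certificate-side letter
`Theorems.palasekTowerBreakdown_episodeBase_of_lineGerm_nearFreeRun` (p515004).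

THE TWO STUBS.

* `stub_strain_door : StrainDoor` (analysis, register-generic, size L–XL) — an a-posteriori existence-and-shadowing
  theorem on `ℝ³` at unit viscosity on an ARBITRARY window `[t₀, t₁]` (v2: window-generic, hence register-free and
  RE-BASE-proof; instantiated at `[1, Host.τfirst]` in the composition) whose Grönwall rate is the SYMMETRIC
  GRADIENT of the reference, not its speed: given a classical PSEUDO-RUN `(w, ϖ)` forced by its own defect `r`
  (`∂ₜw + (w·∇)w + ∇ϖ = Δw + r`; `r` need not be divergence free, `ϖ` is the certificate's choice), continuous
  majorants `σ ≥ sup_x ‖sym ∇w‖` (as the quadratic form `|⟪∇w(x)ξ, ξ⟫| ≤ σ‖ξ‖²`), `σ₂ ≥ sup‖D²w‖`,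
  `σ₃ ≥ sup‖D³w‖`, a free length `κ > 0`, the datum defect `(D₀, D₁, D₂)` = `L²` norms of `U − w(t₀)` and its first
  two derivatives (datum defect taken at `t₀`), the residual defect `(G₀, G₁, G₂)` likewise for `r(t)`, and writing
  `T = t₁ − t₀`, `B = (D₀ + κD₁ + κ²D₂) + T·(G₀ + κG₁ + κ²G₂)`, `Λ = ∫_{t₀}^{t₁} (6σ + 12κσ₂ + 4κ²σ₃) dt`:
  IF `B·e^{Λ/2} ≤ κ²/(100 (1 + T)^{3/4})` (nonlinear threshold) and `4·B·e^{Λ/2} ≤ δ κ^{3/2}` THEN the free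
  classical finite-energy run `v` from `v(t₀) = U` exists on the window and `‖v − w‖ ≤ δ` pointwise there.
  MECHANISM (why no `M²/ν`): for the difference `w̃ = v − w` every trilinear term pairs, after one integration by
  parts, to a quadratic form in `S_w = sym ∇w` — `⟪(w̃·∇)w, w̃⟫ = w̃ᵀS_w w̃`, `⟪(w·∇)w̃, Δw̃⟫ = −Σᵢ (∇w̃ᵢ)ᵀS_w ∇w̃ᵢ`
  (transport drops, `div w = 0`), `⟪(w̃·∇)w, Δw̃⟫ = −Σₖ (∂ₖw̃)ᵀ S_w ∂ₖw̃ − w̃ⱼ ∂ⱼ∂ₖwᵢ ∂ₖw̃ᵢ`, and at `H²` level three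
  such forms plus `‖D²w‖_∞`, `‖D³w‖_∞` cross terms — so the weighted functional
  `E_κ = ‖w̃‖² + κ²‖∇w̃‖² + κ⁴‖D²w̃‖²` obeys `E' ≤ (6σ + 12κσ₂ + 4κ²σ₃)E + (cubic, absorbed by dissipation below the
  threshold) + 2√(E_κ(r))√E`, and the sup distance follows from Agmon's inequality on `ℝ³` with constant `≤ 1/2`
  (`‖f‖_∞ ≤ (√2/π) ‖∇f‖₂^{1/2} ‖Δf‖₂^{1/2}`). The printed doors (Dashti–Robinson 2008 Thm. 1/5, Robinson–Rodrigo–Sadowski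
  2016 Thm. 9.1, the tree's T³ `Torus.classicalNS_robustness_*` and the `ℝ³` sup-norm door
  `Germ.LineGermData.exists_sliceRun_of_pseudoRun`) carry `M²/ν` in the rate because they bound `|⟪(u·∇)w, Δw⟫| ≤
  M‖∇w‖‖Δw‖`; at `wide` that prices the defect at `e^{-5.7·10³} … e^{-1.57·10⁴}`
  (`Germ.shadowing_rate_gt`, `Germ.defect_le_exp_neg_of_door_hypothesis`), i.e. CLOSED. In strain currency the fee is
  `e^{Λ/2} = e^{3∫ sup‖S_w‖ dt + …}`, a DESIGN-DEPENDENT number not bounded below by the register (the strain floors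
  `A₀, A₁` bind only at the two readout instants), MODEL-estimated `e^{20} … e^{60}` for a lazily focusing reference —
  purchasable by a high-precision computation with interval residuals, where `slot` needs an exact explicit solution.
* `stub_strain_certificate : StrainCertificate` (the mechanism; OPEN; may be FALSE at `wide` — census HOLDER-CENSUS
  v6a: every explicit family so far reads `𝔄 ≤ 1.48 < 37/18`) — SOME explicit germ design `d : LineGermData U ρ σ₀ ε₀ c₄`
  and SOME pseudo-run `w` from near `U` with a strain budget meeting the two inequalities for some `δ`, whose slice at
  `Host.τfirst` shows the four faces with margins `η > 0`, `δ` (cap `≤ (5/3)Y₁ − η − δ` throughout, speed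
  `≥ Y₁ + η + δ`, finite-difference strain `(A₁ + η)‖x₁ − x₀‖ + 2δ < ‖w(x₁) − w(x₀)‖`, core circulation
  `≥ N₁^{β−2} + η + δ·8π/N₁`, all in `B̄(0, ρ)`).

COMPOSITION `EpisodeBase_of : StrainDoor → StrainCertificate → EpisodeBase` = the door applied to the certificate's
pseudo-run, then p515004 BY NAME. Disproof used: there is no `Cruxes/EpisodeBase/Disproof.lean`; the line honours the
landed negatives `Theorems/EpisodeBase/Negative/*` (zero-impulse / first-episode-R lemmas concern EXACT explicit slice
runs and forced first episodes; this line's run is the door's output, not an explicit family) and the price rows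
`PalasekTowerGermHostShadowedRunPrice` (it changes the currency those rows price, it does not dispute them).
WHAT THIS IS NOT: not Navier–Stokes evidence — a skeleton; both stubs are OPEN (`sorry`); no run, no certificate, no
claim that a design meeting the faces exists at `wide`; nothing about `RungG 1`, later windows or blow-up.
[cite: Palasek2026ElementaryModel, §4] [cite: DashtiRobinson2008, Thm. 5] [cite: RobinsonRodrigoSadowski2016, Thm. 9.1]
[cite: ChernyshenkoConstantinRobinsonTiti2007, Thm. 2] -/

noncomputable section

set_option linter.dupNamespace false

namespace Summit.NavierStokesRegularity.NavierStokesRegularity.Cruxes.EpisodeBase.StrainDoor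

open Set MeasureTheory Metric
open scoped ENNReal
open Literature.Analysis Literature.Analysis.FluidPDE Literature.Analysis.FunctionSpaces
open Summit.NavierStokesRegularity.FluidComputer.PalasekTowerClayBridge
open Summit.NavierStokesRegularity.FluidComputer.PalasekTowerClayBridge.Germ

/-- **Strain-currency budget of a pseudo-run** `(w, ϖ)` forced by its defect `r` on a window `[t₀, t₁]` (`t₀ < t₁`) at unit
viscosity, relative to the datum `U` at `t₀`: the run, finite energy and `H^∞ ∩ W^{∞,∞}` slices, the strain / Hessian /
third-derivative majorants `σ, σ₂, σ₃` (continuous on the window), the free length `κ > 0`, the datum defect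
`(D₀, D₁, D₂)` and residual defect `(G₀, G₁, G₂)` in `L²` (as `eLpNorm` bounds — no junk values), the nonlinear
threshold and the closeness inequality for the target sup distance `δ`. [cite: DashtiRobinson2008, Thm. 5] -/
structure StrainBudgetOn (t₀ t₁ : ℝ) (U : EuclideanSpace ℝ (Fin 3) → EuclideanSpace ℝ (Fin 3))
    (w r : ℝ → EuclideanSpace ℝ (Fin 3) → EuclideanSpace ℝ (Fin 3)) (ϖ : ℝ → EuclideanSpace ℝ (Fin 3) → ℝ)
    (σ σ₂ σ₃ : ℝ → ℝ) (κ D₀ D₁ D₂ G₀ G₁ G₂ δ : ℝ) : Prop where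
  /-- the window is a genuine interval -/
  window : t₀ < t₁
  /-- `(w, ϖ)` is a classical solution of Navier–Stokes at unit viscosity on the window FORCED BY ITS DEFECT `r`. -/
  run : IsClassicalNSSolutionOn (Icc t₀ t₁) 1 r w ϖ
  /-- finite energy, uniformly on the window -/
  energy : ∃ C : ℝ≥0∞, C < ⊤ ∧ ∀ t ∈ Icc t₀ t₁, ∫⁻ x, ‖w t x‖ₑ ^ 2 ≤ C
  /-- every slice is a smooth field with bounded derivatives and all derivatives in `L²` … -/
  sobolev : ∀ t ∈ Icc t₀ t₁, IsSmoothL2Field (w t)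
  /-- … with ONE bound for the `H³` norm of the slices on the whole window (no quantitative role) -/
  slices_H3 : ∃ K : ℝ, ∀ t ∈ Icc t₀ t₁,
    eLpNorm (w t) 2 volume ≤ ENNReal.ofReal K ∧
    eLpNorm (fun x => fderiv ℝ (w t) x) 2 volume ≤ ENNReal.ofReal K ∧
    eLpNorm (fun x => iteratedFDeriv ℝ 2 (w t) x) 2 volume ≤ ENNReal.ofReal K ∧
    eLpNorm (fun x => iteratedFDeriv ℝ 3 (w t) x) 2 volume ≤ ENNReal.ofReal K
  /-- the pressure gradient of the pseudo-run is square integrable on every slice (so it pairs to zero with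
  divergence-free `H¹` fields: no force hides in `ϖ`) -/
  pressure : ∀ t ∈ Icc t₀ t₁, eLpNorm (fun x => gradient (ϖ t) x) 2 volume < ⊤
  /-- the defect is jointly continuous on the window -/
  resid_cont : ContinuousOn (Function.uncurry r) (Icc t₀ t₁ ×ˢ univ)
  /-- the free length is positive -/
  κ_pos : 0 < κ
  /-- STRAIN MAJORANT: the quadratic form of `∇w(t, x)` (i.e. of its symmetric part) is bounded by `σ t` -/
  strain : ∀ t ∈ Icc t₀ t₁, ∀ x ξ : EuclideanSpace ℝ (Fin 3),
    |inner ℝ (fderiv ℝ (w t) x ξ) ξ| ≤ σ t * ‖ξ‖ ^ 2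
  /-- Hessian majorant -/
  hess : ∀ t ∈ Icc t₀ t₁, ∀ x, ‖iteratedFDeriv ℝ 2 (w t) x‖ ≤ σ₂ t
  /-- third-derivative majorant -/
  third : ∀ t ∈ Icc t₀ t₁, ∀ x, ‖iteratedFDeriv ℝ 3 (w t) x‖ ≤ σ₃ t
  /-- the majorants are continuous on the window (so `Λ` below is a genuine integral) -/
  σ_cont : ContinuousOn σ (Icc t₀ t₁)
  σ₂_cont : ContinuousOn σ₂ (Icc t₀ t₁)
  σ₃_cont : ContinuousOn σ₃ (Icc t₀ t₁)
  D₀_nonneg : 0 ≤ D₀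
  D₁_nonneg : 0 ≤ D₁
  D₂_nonneg : 0 ≤ D₂
  G₀_nonneg : 0 ≤ G₀
  G₁_nonneg : 0 ≤ G₁
  G₂_nonneg : 0 ≤ G₂
  /-- DATUM DEFECT in `L²`, `H¹`-seminorm, `H²`-seminorm -/
  datum₀ : eLpNorm (fun x => U x - w t₀ x) 2 volume ≤ ENNReal.ofReal D₀
  datum₁ : eLpNorm (fun x => fderiv ℝ (fun y => U y - w t₀ y) x) 2 volume ≤ ENNReal.ofReal D₁
  datum₂ : eLpNorm (fun x => iteratedFDeriv ℝ 2 (fun y => U y - w t₀ y) x) 2 volume ≤ ENNReal.ofReal D₂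
  /-- RESIDUAL DEFECT in `L²`, `H¹`-seminorm, `H²`-seminorm, uniformly on the window -/
  resid₀ : ∀ t ∈ Icc t₀ t₁, eLpNorm (r t) 2 volume ≤ ENNReal.ofReal G₀
  resid₁ : ∀ t ∈ Icc t₀ t₁, eLpNorm (fun x => fderiv ℝ (r t) x) 2 volume ≤ ENNReal.ofReal G₁
  resid₂ : ∀ t ∈ Icc t₀ t₁,
    eLpNorm (fun x => iteratedFDeriv ℝ 2 (r t) x) 2 volume ≤ ENNReal.ofReal G₂
  /-- NONLINEAR THRESHOLD: `B e^{Λ/2} ≤ κ² / (100 (1 + T)^{3/4})`, `T = t₁ − t₀` -/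
  threshold :
    ((D₀ + κ * D₁ + κ ^ 2 * D₂) + (t₁ - t₀) * (G₀ + κ * G₁ + κ ^ 2 * G₂)) *
        Real.exp ((∫ t in t₀..t₁, (6 * σ t + 12 * κ * σ₂ t + 4 * κ ^ 2 * σ₃ t)) / 2) ≤
      κ ^ 2 / (100 * (1 + (t₁ - t₀)) ^ (3 / 4 : ℝ))
  /-- CLOSENESS: `4 B e^{Λ/2} ≤ δ κ^{3/2}` (Agmon: `sup |v − w| ≤ 4 B e^{Λ/2} κ^{-3/2}`) -/
  closeness :
    4 * ((D₀ + κ * D₁ + κ ^ 2 * D₂) + (t₁ - t₀) * (G₀ + κ * G₁ + κ ^ 2 * G₂)) *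
        Real.exp ((∫ t in t₀..t₁, (6 * σ t + 12 * κ * σ₂ t + 4 * κ ^ 2 * σ₃ t)) / 2) ≤
      δ * κ ^ (3 / 2 : ℝ)

/-- **Stub statement 1 — THE STRAIN-CURRENCY DOOR** (a-posteriori existence and sup-shadowing on `ℝ³` with the
symmetric-gradient rate): for a smooth compactly supported divergence-free datum `U` and any pseudo-run with a strain
budget for `δ` on a window `[t₀, t₁]`, the free classical finite-energy run from `U` at `t₀` exists on `[t₀, t₁]` and stays
`δ`-close to the pseudo-run pointwise (WINDOW-GENERIC, register-free; used below on the first growth window `[1, Host.τfirst]`).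
[cite: DashtiRobinson2008, Thm. 5] [cite: RobinsonRodrigoSadowski2016, Thm. 9.1] -/
def StrainDoor : Prop :=
  ∀ {t₀ t₁ : ℝ} (U : EuclideanSpace ℝ (Fin 3) → EuclideanSpace ℝ (Fin 3))
    (w r : ℝ → EuclideanSpace ℝ (Fin 3) → EuclideanSpace ℝ (Fin 3)) (ϖ : ℝ → EuclideanSpace ℝ (Fin 3) → ℝ)
    (σ σ₂ σ₃ : ℝ → ℝ) (κ D₀ D₁ D₂ G₀ G₁ G₂ δ : ℝ),
    ContDiff ℝ ((⊤ : ℕ∞) : WithTop ℕ∞) U → HasCompactSupport U → VectorCalculus.IsDivFree U →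
    StrainBudgetOn t₀ t₁ U w r ϖ σ σ₂ σ₃ κ D₀ D₁ D₂ G₀ G₁ G₂ δ →
    ∃ (v : ℝ → EuclideanSpace ℝ (Fin 3) → EuclideanSpace ℝ (Fin 3)) (q : ℝ → EuclideanSpace ℝ (Fin 3) → ℝ),
      IsClassicalNSSolutionOn (Icc t₀ t₁) 1 0 v q ∧ v t₀ = U ∧
      (∃ C : ℝ≥0∞, C < ⊤ ∧ ∀ t ∈ Icc t₀ t₁, ∫⁻ x, ‖v t x‖ₑ ^ 2 ≤ C) ∧
      ∀ t ∈ Icc t₀ t₁, ∀ x, ‖v t x - w t x‖ ≤ δ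

/-- **Stub statement 2 — THE STRAIN CERTIFICATE** (the mechanism): SOME explicit germ design filling
`Germ.LineGermData`, SOME pseudo-run with a strain budget for some `δ`, whose slice at `Host.τfirst` is continuous and
shows the four faces with margins `η > 0`, `δ` (the readouts of p515004). [cite: Palasek2026ElementaryModel, §4] -/
def StrainCertificate : Prop :=
  ∃ (U : EuclideanSpace ℝ (Fin 3) → EuclideanSpace ℝ (Fin 3)) (ρ σ₀ ε₀ c₄ : ℝ) (_ : LineGermData U ρ σ₀ ε₀ c₄)
    (w r : ℝ → EuclideanSpace ℝ (Fin 3) → EuclideanSpace ℝ (Fin 3)) (ϖ : ℝ → EuclideanSpace ℝ (Fin 3) → ℝ)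
    (σ σ₂ σ₃ : ℝ → ℝ) (κ D₀ D₁ D₂ G₀ G₁ G₂ δ η : ℝ),
    StrainBudgetOn 1 Host.τfirst U w r ϖ σ σ₂ σ₃ κ D₀ D₁ D₂ G₀ G₁ G₂ δ ∧
    Continuous (w Host.τfirst) ∧ 0 < η ∧
    (∀ t ∈ Icc (1 : ℝ) Host.τfirst, ∀ x, ‖w t x‖ ≤ 5 / 3 * TowerRates.wide.Y 1 - η - δ) ∧
    (∃ x, ‖x‖ ≤ ρ ∧ TowerRates.wide.Y 1 + η + δ ≤ ‖w Host.τfirst x‖) ∧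
    (∃ x₀ x₁, ‖x₀‖ ≤ ρ ∧ ‖x₁‖ ≤ ρ ∧
      (TowerRates.wide.A 1 + η) * ‖x₁ - x₀‖ + 2 * δ < ‖w Host.τfirst x₁ - w Host.τfirst x₀‖) ∧
    (∃ (x : EuclideanSpace ℝ (Fin 3)) (γ : ℝ → EuclideanSpace ℝ (Fin 3)),
      ‖x‖ ≤ ρ ∧ ContDiff ℝ 1 γ ∧ γ 0 = γ 1 ∧
      (∀ s ∈ Icc (0 : ℝ) 1, γ s ∈ closedBall x (1 / TowerRates.wide.N 1)) ∧
      (∀ s ∈ Icc (0 : ℝ) 1, ‖deriv γ s‖ ≤ 8 * Real.pi / TowerRates.wide.N 1) ∧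
      TowerRates.wide.N 1 ^ (TowerRates.wide.β - 2) + η + δ * (8 * Real.pi / TowerRates.wide.N 1) ≤
        circulation (w Host.τfirst) γ)

/-- registered stub 1 (OPEN — analysis): the strain-currency door. -/
theorem stub_strain_door : StrainDoor := by
  sorry

/-- registered stub 2 (OPEN — the mechanism): one explicit design and one certified pseudo-run in strain currency. -/
theorem stub_strain_certificate : StrainCertificate := by
  sorry

/-! ## Name-keyed aliases of the stub statements (hypotheses of `EpisodeBase_of`; device of `Lines/birth.lean`) -/
namespace __Registered

/-- Alias of the statement of `stub_strain_door`, keyed by the stub name. -/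
abbrev stub_strain_door : Prop := StrainDoor

/-- Alias of the statement of `stub_strain_certificate`, keyed by the stub name. -/
abbrev stub_strain_certificate : Prop := StrainCertificate

end __Registered

/-- The composition: the door applied to the certificate, then the landed certificate-side letter p515004 BY NAME.
[cite: Palasek2026ElementaryModel, §4] -/
theorem EpisodeBase_of : __Registered.stub_strain_door → __Registered.stub_strain_certificate →
    Summit.NavierStokesRegularity.NavierStokesRegularity.Theses.PalasekTowerBreakdown.EpisodeBase := by
  intro hdoor hcert
  dsimp only [__Registered.stub_strain_door, __Registered.stub_strain_certificate] at hdoor hcert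
  obtain ⟨U, ρ, σ₀, ε₀, c₄, d, w, r, ϖ, σ, σ₂, σ₃, κ, D₀, D₁, D₂, G₀, G₁, G₂, δ, η, hB, hwc, hη, hcap, hspeed,
    hstrain, hcore⟩ := hcert
  obtain ⟨v, q, hv, hv1, hvE, hnear⟩ :=
    hdoor U w r ϖ σ σ₂ σ₃ κ D₀ D₁ D₂ G₀ G₁ G₂ δ d.smooth
      (IsCompact.of_isClosed_subset (isCompact_closedBall (0 : EuclideanSpace ℝ (Fin 3)) ρ) (isClosed_tsupport U)
        d.support) d.divFree hB
  exact Summit.NavierStokesRegularity.NavierStokesRegularity.Theorems.palasekTowerBreakdown_episodeBase_of_lineGerm_nearFreeRun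
    d hv hv1 hvE hnear hwc hη hcap hspeed hstrain hcore

/-- The hypothesis-free skeleton line (carries the stubs' `sorry`s). -/
theorem EpisodeBase_skeleton :
    Summit.NavierStokesRegularity.NavierStokesRegularity.Theses.PalasekTowerBreakdown.EpisodeBase :=
  EpisodeBase_of stub_strain_door stub_strain_certificate

end Summit.NavierStokesRegularity.NavierStokesRegularity.Cruxes.EpisodeBase.StrainDoor

end
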